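import Mathlib
import HarnessLib

/-!
# Crux `HypACumulant`, line `gnv` — DOMINATED HOLOMORPHY of parametric integrals: `σ ↦ ∫ f(σ, z) dμ(z)`
# is holomorphic when `f(·, z)` is and `|f| ≤ g ∈ L¹` uniformly on the disc

Route `route-HubbardSuperconductivity-ComplexGFFStiffness`, cruxes stmt-HubbardSuperconductivity-19154 /
-19155, shared research statement `OnePointLipschitz`, census (C3d′) (memo §7, step S4b).  The fluctuation
integral `R_{k+1}` of [ABKM19] (6.9) along a complex line `(H + σU, K + σV)` is a parametric Gaussian
integral of an integrand entire in `σ` (`…HolomorphicMidK`, `…HolomorphicNextH`); holomorphy of the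
integral needs only a `σ`-uniform integrable bound (the tree's weight domination), NOT a bound on the
`σ`-derivative — Cauchy's estimate supplies the derivative bound on a smaller disc:

* **`differentiableOn_integral_of_dominated_holomorphic`** — `f : ℂ → Z → ℂ`, `f σ` a.e.-strongly
  measurable for `σ` in the disc `|σ| < R`, for a.e. `z` the map `σ ↦ f σ z` holomorphic on the disc,
  and `‖f σ z‖ ≤ g z` there with `g` integrable: then `σ ↦ ∫ f σ z dμ` is holomorphic on the disc.

Pure analysis (Mathlib: `hasDerivAt_integral_of_dominated_loc_of_deriv_le` over `ℂ`, Cauchy's estimate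
`Complex.norm_deriv_le_of_forall_mem_sphere_norm_le`, measurability of the derivative as an a.e. limit of
difference quotients).  All proved, no `sorry`.

## References
* S. Adams, S. Buchholz, R. Kotecký, S. Müller, arXiv:1910.13564, (6.9), Lemma 8.4 [AdamsBuchholzKoteckyMuller2019].
-/

noncomputable section

-- `Summit.<Summit>.<Problem>`: single-conjunct summit, the duplicate component is mandated (D-0017).
set_option linter.dupNamespace false

namespace Summit.HubbardSuperconductivity.HubbardSuperconductivity.Theorems.ComplexGFF

open MeasureTheory Metric Set Filter Topology

variable {Z : Type*} [MeasurableSpace Z] {μ : Measure Z}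

/-- **Dominated holomorphy of parametric integrals.** -/
theorem differentiableOn_integral_of_dominated_holomorphic {f : ℂ → Z → ℂ} {R : ℝ} {g : Z → ℝ}
    (hmeas : ∀ σ ∈ ball (0 : ℂ) R, AEStronglyMeasurable (f σ) μ)
    (hhol : ∀ᵐ z ∂μ, DifferentiableOn ℂ (fun σ => f σ z) (ball (0 : ℂ) R))
    (hbound : ∀ᵐ z ∂μ, ∀ σ ∈ ball (0 : ℂ) R, ‖f σ z‖ ≤ g z) (hg : Integrable g μ) :
    DifferentiableOn ℂ (fun σ => ∫ z, f σ z ∂μ) (ball (0 : ℂ) R) := by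
  intro σ₀ hσ₀
  have hσ₀' : ‖σ₀‖ < R := mem_ball_zero_iff.mp hσ₀
  -- a smaller disc around `σ₀`
  set r : ℝ := (R - ‖σ₀‖) / 2 with hr
  have hr0 : 0 < r := by rw [hr]; linarith
  have hsub : ∀ σ ∈ ball σ₀ r, closedBall σ r ⊆ ball (0 : ℂ) R := by
    intro σ hσ w hw
    rw [mem_ball_zero_iff]
    rw [mem_ball, dist_eq_norm] at hσ
    rw [mem_closedBall, dist_eq_norm] at hw
    have e : w = (w - σ) + (σ - σ₀) + σ₀ := by abel
    have h1 : ‖(w - σ) + (σ - σ₀) + σ₀‖ ≤ ‖(w - σ) + (σ - σ₀)‖ + ‖σ₀‖ := norm_add_le _ _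
    have h2 : ‖(w - σ) + (σ - σ₀)‖ ≤ ‖w - σ‖ + ‖σ - σ₀‖ := norm_add_le _ _
    calc ‖w‖ = ‖(w - σ) + (σ - σ₀) + σ₀‖ := by rw [← e]
      _ ≤ ‖w - σ‖ + ‖σ - σ₀‖ + ‖σ₀‖ := by linarith
      _ < r + r + ‖σ₀‖ := by linarith
      _ = R := by rw [hr]; ring
  have hball_sub : ball σ₀ r ⊆ ball (0 : ℂ) R := fun σ hσ => hsub σ hσ (mem_closedBall_self hr0.le)
  -- the derivative family and its bound by Cauchy's estimate
  set F' : ℂ → Z → ℂ := fun σ z => deriv (fun σ' => f σ' z) σ with hF'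
  have hderiv_bound : ∀ᵐ z ∂μ, ∀ σ ∈ ball σ₀ r, ‖F' σ z‖ ≤ g z / r := by
    filter_upwards [hhol, hbound] with z hz hbz σ hσ
    have hdc : DiffContOnCl ℂ (fun σ' => f σ' z) (ball σ r) := by
      refine DifferentiableOn.diffContOnCl ?_
      rw [closure_ball σ hr0.ne']
      exact hz.mono (hsub σ hσ)
    refine Complex.norm_deriv_le_of_forall_mem_sphere_norm_le hr0 hdc (fun w hw => hbz w ?_)
    exact hsub σ hσ (sphere_subset_closedBall hw)
  have hderiv_at : ∀ᵐ z ∂μ, ∀ σ ∈ ball σ₀ r, HasDerivAt (fun σ' => f σ' z) (F' σ z) σ := by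
    filter_upwards [hhol] with z hz σ hσ
    exact (hz.differentiableAt (isOpen_ball.mem_nhds (hball_sub hσ))).hasDerivAt
  -- measurability of `F' σ₀` as an a.e. limit of difference quotients
  have hF'_meas : AEStronglyMeasurable (F' σ₀) μ := by
    set h : ℕ → ℂ := fun n => ((r / ((n : ℝ) + 2) : ℝ) : ℂ) with hh
    have hh0 : ∀ n, h n ≠ 0 := fun n => by
      rw [hh]
      exact Complex.ofReal_ne_zero.mpr (by positivity)
    have hhmem : ∀ n, σ₀ + h n ∈ ball (0 : ℂ) R := by
      intro n
      apply hball_sub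
      rw [mem_ball, dist_eq_norm, add_sub_cancel_left, hh, Complex.norm_real, Real.norm_eq_abs,
        abs_of_pos (by positivity)]
      have h2 : (1 : ℝ) < (n : ℝ) + 2 := by linarith [Nat.cast_nonneg (α := ℝ) n]
      exact div_lt_self hr0 h2
    have htend : Tendsto h atTop (𝓝[≠] 0) := by
      refine tendsto_nhdsWithin_of_tendsto_nhds_of_eventually_within _ ?_ (Eventually.of_forall hh0)
      have h1 : Tendsto (fun n : ℕ => r / ((n : ℝ) + 2)) atTop (𝓝 0) := by
        have := tendsto_const_div_atTop_nhds_zero_nat r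
        have h2 : Tendsto (fun n : ℕ => ((n : ℝ) + 2)) atTop atTop :=
          tendsto_atTop_add_const_right _ 2 tendsto_natCast_atTop_atTop
        exact tendsto_const_nhds.div_atTop h2
      have h3 := Complex.continuous_ofReal.continuousAt.tendsto.comp h1
      rw [Complex.ofReal_zero] at h3
      exact h3.congr (fun n => rfl)
    refine aestronglyMeasurable_of_tendsto_ae atTop
      (f := fun n z => (h n)⁻¹ • (f (σ₀ + h n) z - f σ₀ z)) (fun n => ?_) ?_
    · have hm := ((hmeas _ (hhmem n)).sub (hmeas σ₀ hσ₀)).const_smul ((h n)⁻¹)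
      exact hm.congr (ae_of_all _ fun z => rfl)
    · filter_upwards [hderiv_at] with z hz
      have ht := (hz σ₀ (mem_ball_self hr0)).tendsto_slope_zero
      exact ht.comp htend
  have hF_int : Integrable (f σ₀) μ := by
    refine hg.mono' (hmeas σ₀ hσ₀) ?_
    filter_upwards [hbound] with z hz
    exact hz σ₀ hσ₀
  have hmain := hasDerivAt_integral_of_dominated_loc_of_deriv_le (F := f) (F' := F') (x₀ := σ₀)
    (ball_mem_nhds σ₀ hr0) ?_ hF_int hF'_meas hderiv_bound (hg.div_const r) hderiv_at
  · exact hmain.2.differentiableAt.differentiableWithinAt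
  · filter_upwards [ball_mem_nhds σ₀ hr0] with σ hσ
    exact hmeas σ (hball_sub hσ)

end Summit.HubbardSuperconductivity.HubbardSuperconductivity.Theorems.ComplexGFF

end
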